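import Summits.AtomisticToContinuum.Crystallization.Theorems.FrustratedLawDichotomyCellKitXMove
import Summits.AtomisticToContinuum.Crystallization.Theorems.FrustratedLawDichotomyCollarKillGlue
import Summits.AtomisticToContinuum.Crystallization.Theorems.FrustratedLawDichotomyPeriodicBlockFlagsX

/-!
# FrustratedLawDichotomy · crux `AperiodicFrustratedLawGap` (stmt-AtomisticToContinuum-27623) — CELL KIT X, ASSEMBLY: ★★ `checkMove ⟹ ¬MoveUnstableCore`,
# the X-kernel binder `hnex` from accepted checks, and ★★ the KILL of the collared T-pieces at a levy `κ_T` by an accepted all-bad cell certificate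
# (decomp-a2c, prover hand 2, generation 17; critic row 592 (3) recipe, steps «hand-2 kernels → not_nonEquilibriumCore_block_of_classCerts →
# not_schurTopologicalPricingX_of_cell_allBad_nonExempt → not_collarPieces…_of_not_schurX»)

* §1 ★★ `not_moveUnstableCore_of_check` — `…CollarNonExempt.not_moveUnstableCore_of_bregmanCert_closed` with every hypothesis discharged by
  `…CellKitXMove` / `…CollarNonExemptBins` from `checkMove c P X m = true`;
* §2 ★ `hnex_of_checks` — accepted move/removal checks at every class ⟹ the X-kernel binder for `Ex := NonEquilibriumCore eUp ε Rm s tR` at every interior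
  site of every block (`…CollarKillGlue.not_nonEquilibriumCore_block_of_classCerts`; margin `cB(Rm + diam) < k₀ + 1` is part of `checkParams`);
* §3 ★★ `not_schurTopologicalPricingX_of_checks` — hand-1's all-bad class certificates (`checkClassBad`, badness + `W₄₅` site sums) + §2 ⟹
  `¬SchurTopologicalPricingX (1/20) (1/8) w₄₅ ω₄ (3/400) eUp κ_T C_T D_T (NonEquilibriumCore …)` for every `C_T, D_T` once the certified mean priced site
  energy is `< eUp + κ_T`; ★★ `not_collarPiecesK_record_of_checks` — at the record literals `(eUp, ε, Rm, s, t) = (−0.7175, 10⁻⁴, 7, 1/20, 10⁻⁴)` this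
  REFUTES `F1^X♯(κ_T) ∧ CC♯(κ_T) ∧ DD♯(κ_T)` (`0 ≤ κ_T ≤ 1`).  The data file (a cell with `κ* < κ_T`, e.g. census TEQ15 for `κ_T = 1/100`) is separate.
All `[folklore]`; 0 sorry.
-/

noncomputable section

namespace Summit.AtomisticToContinuum.Crystallization.Theorems.FrustratedLawDichotomyCellKitX

open scoped BigOperators RealInnerProductSpace
open Literature.MathematicalPhysics.StatisticalMechanics (lennardJones)
open Summit.AtomisticToContinuum.Crystallization.Theorems.ChargedEnergyGapNegative (E3)
open Summit.AtomisticToContinuum.Crystallization.Theorems.FrustratedLawDichotomySchurCut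
open Summit.AtomisticToContinuum.Crystallization.Theorems.FrustratedLawDichotomyAveragingCut (Mball CT₄₅)
open Summit.AtomisticToContinuum.Crystallization.Theorems.FrustratedLawDichotomyCellChecker
  (Cell ClassCertBad roundUp le_roundUp allBelow sumBelow allBelow_spec sumBelow_eq ubTerm effPot_le_ubTerm)
open Summit.AtomisticToContinuum.Crystallization.Theorems.FrustratedLawDichotomyCellKitF
  (cellμ cellσ cellIdx cellMid cellμσ_injective sum_cell_eq cellIdx_spec abs_cellσ_le cell_sup)
open Summit.AtomisticToContinuum.Crystallization.Theorems.FrustratedLawDichotomyCellKitW (effPot_fourHalf_le effPot_fourHalf_zero)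
open Summit.AtomisticToContinuum.Crystallization.Theorems.FrustratedLawDichotomyPeriodicBlockKernel (PerSep block Interior superMotif_injective)
open Summit.AtomisticToContinuum.Crystallization.Theorems.FrustratedLawDichotomyPeriodicBlockFlagsX (not_schurTopologicalPricingX_of_cell_allBad_nonExempt)
open Summit.AtomisticToContinuum.Crystallization.Theorems.FrustratedLawDichotomyExemptSplit (SchurTopologicalPricingX)
open Summit.AtomisticToContinuum.Crystallization.Theorems.FrustratedLawDichotomyExemptAbsorptionRecord
  (MoveUnstableCore RemovalUnstableCore NonEquilibriumCore)
open Summit.AtomisticToContinuum.Crystallization.Theorems.FrustratedLawDichotomyCollarCensus (CollarCore)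
open Summit.AtomisticToContinuum.Crystallization.Theorems.FrustratedLawDichotomyCollarCensusKappa
open Summit.AtomisticToContinuum.Crystallization.Theorems.FrustratedLawDichotomyCollarKillGlue
  (not_nonEquilibriumCore_block_of_classCerts not_collarPiecesK_record_of_not_schurX)
open Summit.AtomisticToContinuum.Crystallization.Theorems.FrustratedLawDichotomyCollarNonExempt (not_moveUnstableCore_of_bregmanCert_closed)
open Summit.AtomisticToContinuum.Crystallization.Theorems.FrustratedLawDichotomyCollarNonExemptCoords (norm_sum_smul_le_of_coords)
open Summit.AtomisticToContinuum.Crystallization.Theorems.FrustratedLawDichotomyCollarNonExemptBins (hA_of_ldl_lo norm_sum_smul_le_of_enclosures)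

variable (c : Cell)

/-! ## §1. The move test from the accepted check -/

/-- The allowance of the predicate is the cast of `slackQ`. [folklore] -/
theorem cast_slackQ (ε s Rm : ℚ) :
    ((slackQ ε s Rm : ℚ) : ℝ) =
      (ε : ℝ) + s * (Rm / (Rm - s)) ^ 7 * (6000 / 343 * (Rm : ℝ)⁻¹ ^ 4 + 2880 / 49 * (Rm : ℝ)⁻¹ ^ 5 + 10 / 7 * (Rm : ℝ)⁻¹ ^ 6 + 2 * (Rm : ℝ)⁻¹ ^ 7) := by
  unfold slackQ; push_cast; ring
set_option maxHeartbeats 400000 in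
/-- ★★ **MOVE SOUNDNESS**: `checkGeom ∧ checkParams ∧ checkMove m ⟹ ¬MoveUnstableCore ε Rm s` at the class centre `cellIdx m` of the supercell motif.
[folklore] -/
theorem not_moveUnstableCore_of_check (hG : c.checkGeom = true) {P : XParams} (hP : checkParams c P = true) {X : XCert} {m : Fin c.N₀}
    (h : checkMove c P X m = true) :
    ¬ MoveUnstableCore (P.ε : ℝ) (P.Rm : ℝ) (P.s : ℝ) (c.N₀ * c.K3) c.zM (cellIdx c.N₀ c.k₀ m) := by
  obtain ⟨hD, -, hsep, -⟩ := c.geom_sound hG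
  have hP' := hP
  simp only [checkParams, Bool.and_eq_true, decide_eq_true_eq] at hP'
  obtain ⟨⟨⟨⟨-, hs0⟩, hsRm⟩, -⟩, -⟩ := hP'
  have hRm : 0 ≤ P.Rm := (hs0.trans hsRm).le
  simp only [checkMove, Bool.and_eq_true, decide_eq_true_eq] at h
  obtain ⟨⟨⟨⟨⟨⟨⟨⟨⟨⟨hbins, hcover⟩, hβ0⟩, hβ⟩, hφ0⟩, hφ⟩, hd0⟩, hd1⟩, hd2⟩, hL⟩, hcert⟩ := h
  -- the pivots, cast to `ℝ`, then the rational sums abstracted as real atoms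
  have hd0R := (Rat.cast_lt (K := ℝ)).2 hd0
  have hd1R := (Rat.cast_lt (K := ℝ)).2 hd1
  have hd2R := (Rat.cast_le (K := ℝ)).2 hd2
  push_cast at hd0R hd1R hd2R
  set SR := ((sumX c (termS c P m) : ℚ) : ℝ) with hSR
  set C00 := ((sumX c (termC c P X.bins 0 0 m) : ℚ) : ℝ) with hC00
  set C01 := ((sumX c (termC c P X.bins 0 1 m) : ℚ) : ℝ) with hC01
  set C02 := ((sumX c (termC c P X.bins 0 2 m) : ℚ) : ℝ) with hC02
  set C11 := ((sumX c (termC c P X.bins 1 1 m) : ℚ) : ℝ) with hC11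
  set C12 := ((sumX c (termC c P X.bins 1 2 m) : ℚ) : ℝ) with hC12
  set C22 := ((sumX c (termC c P X.bins 2 2 m) : ℚ) : ℝ) with hC22
  -- the matrix identities
  have hC := hC_of_check c hD hsep P hRm X.bins m
  have hCsq : ∀ a : Fin 3, ((sumX c (termC c P X.bins a a m) : ℚ) : ℝ) =
      4 * ∑ k ∈ (Finset.univ.erase (cellIdx c.N₀ c.k₀ m)).filter (fun k => dist (c.zM k) (c.zM (cellIdx c.N₀ c.k₀ m)) ≤ (P.Rm : ℝ)),
        ((cOf X.bins (nq c m k) : ℚ) : ℝ) * (c.zM (cellIdx c.N₀ c.k₀ m) - c.zM k) a ^ 2 := by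
    intro a; rw [hC]; congr 1; refine Finset.sum_congr rfl fun k _ => ?_; ring
  have hA := hA_of_ldl_lo ((Finset.univ.erase (cellIdx c.N₀ c.k₀ m)).filter (fun k => dist (c.zM k) (c.zM (cellIdx c.N₀ c.k₀ m)) ≤ (P.Rm : ℝ)))
    (fun k => ((cOf X.bins (nq c m k) : ℚ) : ℝ))
    (fun k => -(1 / 2) * (dist (c.zM (cellIdx c.N₀ c.k₀ m)) (c.zM k) ^ 2)⁻¹ ^ 7 + (1 / 2) * (dist (c.zM (cellIdx c.N₀ c.k₀ m)) (c.zM k) ^ 2)⁻¹ ^ 4)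
    (fun k => c.zM (cellIdx c.N₀ c.k₀ m) - c.zM k) (Slo := SR) (lam := (X.lam : ℝ))
    (l10 := C01 / (SR + C00 - X.lam)) (l20 := C02 / (SR + C00 - X.lam))
    (l21 := (C12 - C02 / (SR + C00 - X.lam) * (C01 / (SR + C00 - X.lam)) * (SR + C00 - X.lam)) /
      (SR + C11 - X.lam - (C01 / (SR + C00 - X.lam)) ^ 2 * (SR + C00 - X.lam)))
    (d0 := SR + C00 - X.lam) (d1 := SR + C11 - X.lam - (C01 / (SR + C00 - X.lam)) ^ 2 * (SR + C00 - X.lam))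
    (d2 := SR + C22 - X.lam - (C02 / (SR + C00 - X.lam)) ^ 2 * (SR + C00 - X.lam) -
      ((C12 - C02 / (SR + C00 - X.lam) * (C01 / (SR + C00 - X.lam)) * (SR + C00 - X.lam)) /
        (SR + C11 - X.lam - (C01 / (SR + C00 - X.lam)) ^ 2 * (SR + C00 - X.lam))) ^ 2 *
        (SR + C11 - X.lam - (C01 / (SR + C00 - X.lam)) ^ 2 * (SR + C00 - X.lam)))
    (hS_of_check c hD hsep P hRm m) hd0R.le hd1R.le hd2R
    (by rw [← hCsq 0]) (by rw [← hC 0 1, div_mul_cancel₀ _ hd0R.ne']) (by rw [← hC 0 2, div_mul_cancel₀ _ hd0R.ne'])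
    (by rw [← hCsq 1]; ring) (by rw [← hC 1 2, div_mul_cancel₀ _ hd1R.ne']; ring) (by rw [← hCsq 2]; ring)
  -- `hB`, `hF`, `hC4`
  have hBv := norm_sum_smul_le_of_coords
    ((Finset.univ.erase (cellIdx c.N₀ c.k₀ m)).filter (fun k => dist (c.zM k) (c.zM (cellIdx c.N₀ c.k₀ m)) ≤ (P.Rm : ℝ)))
    (fun k => 4 * ((cOf X.bins (nq c m k) : ℚ) : ℝ)) (fun k => c.zM (cellIdx c.N₀ c.k₀ m) - c.zM k) (β := (X.beta : ℝ))
    (by exact_mod_cast hβ0)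
    (by
      rw [← hB_of_check c hD hsep P hRm X.bins m 0, ← hB_of_check c hD hsep P hRm X.bins m 1, ← hB_of_check c hD hsep P hRm X.bins m 2]
      exact_mod_cast hβ)
  have hFv := norm_sum_smul_le_of_enclosures
    ((Finset.univ.erase (cellIdx c.N₀ c.k₀ m)).filter (fun k => dist (c.zM k) (c.zM (cellIdx c.N₀ c.k₀ m)) ≤ (P.Rm : ℝ)))
    (fun k => 2 * (-(1 / 2) * (dist (c.zM (cellIdx c.N₀ c.k₀ m)) (c.zM k) ^ 2)⁻¹ ^ 7 + (1 / 2) * (dist (c.zM (cellIdx c.N₀ c.k₀ m)) (c.zM k) ^ 2)⁻¹ ^ 4))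
    (fun k => c.zM (cellIdx c.N₀ c.k₀ m) - c.zM k) (fun a => ((sumX c (termF c P a m) : ℚ) : ℝ)) (τ := ((tauOf c : ℚ) : ℝ))
    (φ := (X.phiF : ℝ)) (by exact_mod_cast hφ0) (fun a => hF_enclosure c hD hsep P hRm m a)
    (by have := (Rat.cast_le (K := ℝ)).2 hφ; push_cast at this; exact this)
  have hC4 := hC4_of_check c hD hsep P hRm X.bins m
  -- the scalar condition
  have hLR : (0 : ℝ) < X.lam - X.beta * P.s + min ((sumX c (termC4 c P X.bins m) : ℚ) : ℝ) 0 * (P.s : ℝ) ^ 2 := by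
    have := (Rat.cast_lt (K := ℝ)).2 hL; push_cast at this; exact this
  have hcertR : ((X.phiF : ℝ)) ^ 2 ≤ 4 * (X.lam - X.beta * P.s + min ((sumX c (termC4 c P X.bins m) : ℚ) : ℝ) 0 * (P.s : ℝ) ^ 2) *
      ((P.ε : ℝ) + P.s * (P.Rm / (P.Rm - P.s)) ^ 7 *
        (6000 / 343 * (P.Rm : ℝ)⁻¹ ^ 4 + 2880 / 49 * (P.Rm : ℝ)⁻¹ ^ 5 + 10 / 7 * (P.Rm : ℝ)⁻¹ ^ 6 + 2 * (P.Rm : ℝ)⁻¹ ^ 7)) := by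
    have := (Rat.cast_le (K := ℝ)).2 hcert
    rw [Rat.cast_mul, Rat.cast_mul, cast_slackQ] at this
    push_cast at this; exact this
  exact not_moveUnstableCore_of_bregmanCert_closed (fun k => ((cOf X.bins (nq c m k) : ℚ) : ℝ))
    (fun k => ((((binOf X.bins (nq c m k)).map fun b => (b.rlo - P.s) ^ 2).getD 0 : ℚ) : ℝ))
    (fun k => ((((binOf X.bins (nq c m k)).map fun b => (b.rhi + P.s) ^ 2).getD 0 : ℚ) : ℝ))
    (X.lam : ℝ) (X.beta : ℝ) (X.phiF : ℝ) ((sumX c (termC4 c P X.bins m) : ℚ) : ℝ) (by exact_mod_cast hβ0)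
    (hrange_of_check c hD hsep hRm hbins hcover) (hbreg_of_check c hD hsep hs0.le hRm hbins hcover) hA hBv hFv hC4.le hLR hcertR

/-! ## §2. The X-kernel binder from accepted checks -/

/-- ★ **`hnex` for `Ex := NonEquilibriumCore eUp ε Rm s tR` from accepted checks at every class**. [folklore] -/
theorem hnex_of_checks (hG : c.checkGeom = true) {P : XParams} (hP : checkParams c P = true) (xc : Fin c.N₀ → XCert)
    (hM : ∀ m, checkMove c P (xc m) m = true) (hR : ∀ m, checkRemoval c P m = true) :
    ∀ (n N : ℕ) (e : (Fin c.N₀ × (Fin 3 → Fin n)) ≃ Fin N) (m : Fin c.N₀) (t : Fin 3 → Fin n), Interior c.k₀ n t →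
      ¬ NonEquilibriumCore (P.eUp : ℝ) (P.ε : ℝ) (P.Rm : ℝ) (P.s : ℝ) (P.tR : ℝ) N (block c.x c.a n ∘ e.symm) (e (m, t)) := by
  obtain ⟨hD, -, hsep, hdual, hb, hdiam, -⟩ := c.geom_sound hG
  have hP' := hP
  simp only [checkParams, Bool.and_eq_true, decide_eq_true_eq] at hP'
  obtain ⟨-, hk⟩ := hP'
  have hkR : (c.cB : ℝ) * ((P.Rm : ℝ) + c.Dq) < (c.k₀ : ℝ) + 1 := by
    have := (Rat.cast_lt (K := ℝ)).2 hk; push_cast at this; exact this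
  exact not_nonEquilibriumCore_block_of_classCerts hsep hdual hb hdiam hkR (abs_cellσ_le c.N₀ c.k₀) (cell_sup c.N₀ c.k₀)
    (cellμσ_injective c.N₀ c.k₀) (cellIdx_spec c.N₀ c.k₀)
    (fun m => not_moveUnstableCore_of_check c hG hP (hM m)) (fun m => not_removalUnstableCore_of_check c hG hP (hR m))

/-! ## §3. The kill of the collared T-pieces by an accepted all-bad cell certificate -/

/-- ★★ **`¬SchurTopologicalPricingX (1/20) (1/8) w₄₅ ω₄ (3/400) eUp κ_T C_T D_T (NonEquilibriumCore eUp′ ε Rm s tR)` from accepted checks**: hand-1's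
all-bad class certificates (badness + site sums with `Σ_m ((Ub_m + 3/200)/2 − 3/400) < N₀(eUp + κ_T)`) and the move/removal checks at every class.
[folklore] -/
theorem not_schurTopologicalPricingX_of_checks (cert : Fin c.N₀ → ClassCertBad c.N₀ c.K3) (hG : c.checkGeom = true)
    (hC : ∀ m, c.checkClassBad m (cert m) = true) {P : XParams} (hP : checkParams c P = true) (xc : Fin c.N₀ → XCert)
    (hM : ∀ m, checkMove c P (xc m) m = true) (hR : ∀ m, checkRemoval c P m = true) {eUp κT : ℝ}
    (hκ : ((∑ m, (((cert m).Ub + 3 / 200) / 2 - 3 / 400) : ℚ) : ℝ) < c.N₀ * (eUp + κT)) (CT DT : ℝ) :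
    ¬ SchurTopologicalPricingX (1 / 20) (1 / 8) w₄₅ ω₄ (3 / 400) eUp κT CT DT
      (NonEquilibriumCore (P.eUp : ℝ) (P.ε : ℝ) (P.Rm : ℝ) (P.s : ℝ) (P.tR : ℝ)) := by
  obtain ⟨hD, hN, hsep, hdual, hb, hdiam, hk⟩ := c.geom_sound hG
  have hN' : (0 : ℝ) < c.N₀ := by exact_mod_cast hN
  set T : ℝ := ((∑ m, (((cert m).Ub + 3 / 200) / 2 - 3 / 400) : ℚ) : ℝ) with hT
  set δ : ℝ := (c.N₀ * (eUp + κT) - T) / c.N₀ with hδ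
  have hδpos : 0 < δ := div_pos (by linarith) hN'
  have hW0 : effPot w₄₅ ω₄ (3 / 400) 0 = -(3 / 200) := effPot_fourHalf_zero
  refine not_schurTopologicalPricingX_of_cell_allBad_nonExempt (ϱ := 9 / 2) hN hsep hdual hb hdiam hk (cellμσ_injective c.N₀ c.k₀)
    (abs_cellσ_le c.N₀ c.k₀) (cell_sup c.N₀ c.k₀) (cellIdx_spec c.N₀ c.k₀) (R := 9 / 2) (Wsup := 7) (by norm_num)
    (fun r hr => effPot_fourHalf_eq_zero _ hr) le_rfl (fun r hr => effPot_fourHalf_le hr) (by norm_num) (D := 2) (by norm_num) (by norm_num)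
    (by norm_num) (fun m => (c.class_sound_bad hD m (cert m) (hC m)).2.1) _ (hnex_of_checks c hG hP xc hM hR) hδpos ?_ CT DT
  have hcls : ∀ m, ((∑ q, effPot w₄₅ ω₄ (3 / 400) (dist (c.x m) (c.zM q))) - effPot w₄₅ ω₄ (3 / 400) 0) / 2 - 3 / 400 ≤
      ((((cert m).Ub + 3 / 200) / 2 - 3 / 400 : ℚ) : ℝ) := by
    intro m
    have := (c.class_sound_bad hD m (cert m) (hC m)).2.2
    rw [hW0]; push_cast; linarith
  calc (∑ m, (((∑ q, effPot w₄₅ ω₄ (3 / 400) (dist (c.x m) (c.zM q))) - effPot w₄₅ ω₄ (3 / 400) 0) / 2 - 3 / 400))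
      ≤ ∑ m, ((((cert m).Ub + 3 / 200) / 2 - 3 / 400 : ℚ) : ℝ) := Finset.sum_le_sum fun m _ => hcls m
    _ = T := by rw [hT]; push_cast; rfl
    _ = c.N₀ * (eUp + κT - δ) := by rw [hδ]; field_simp; ring

/-- ★★★ **THE KILL OF THE COLLARED T-PIECES AT LEVY `κ_T` BY AN ACCEPTED CELL CERTIFICATE** (`0 ≤ κ_T ≤ 1`): all-bad class certificates with certified
mean priced site energy `< −0.7175 + κ_T`, plus accepted move/removal checks at the record exemption parameters ⟹
`¬(F1^X♯(κ_T) ∧ CC♯(κ_T) ∧ DD♯(κ_T))` (the pieces of `…CollarCensusKappa` at the record literals and `ExM♯ = CollarCore (9/2) (−0.7175) 10⁻⁴ 7 (1/20) 10⁻⁴`; the exemption parameters of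
record are the `XParams` literal `⟨7, 1/20, 10⁻⁴, −0.7175, 10⁻⁴⟩`). [folklore] -/
theorem not_collarPiecesK_record_of_checks (cert : Fin c.N₀ → ClassCertBad c.N₀ c.K3) (hG : c.checkGeom = true)
    (hC : ∀ m, c.checkClassBad m (cert m) = true) (hP : checkParams c ⟨7, 1 / 20, 1 / 10000, -(7175 / 10000), 1 / 10000⟩ = true)
    (xc : Fin c.N₀ → XCert) (hM : ∀ m, checkMove c ⟨7, 1 / 20, 1 / 10000, -(7175 / 10000), 1 / 10000⟩ (xc m) m = true)
    (hR : ∀ m, checkRemoval c ⟨7, 1 / 20, 1 / 10000, -(7175 / 10000), 1 / 10000⟩ m = true) {κT : ℝ} (hκ0 : 0 ≤ κT) (hκ1 : κT ≤ 1)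
    (hκ : ((∑ m, (((cert m).Ub + 3 / 200) / 2 - 3 / 400) : ℚ) : ℝ) < c.N₀ * (-(7175 / 10000) + κT)) :
    ¬ (StrainedPatchMotifPricingCapXK κT (9 / 5) (133 / 10) (3 / 2) (effPot w₄₅ ω₄ (3 / 400)) (-(7175 / 10000) + 3 / 400)
          (CollarCore (9 / 2) (-(7175 / 10000)) (1 / 10000) 7 (1 / 20) (1 / 10000)) ∧
        CrowdedCoreMotifPricingCapK κT (9 / 5) (133 / 10) (3 / 2) (effPot w₄₅ ω₄ (3 / 400)) (-(7175 / 10000) + 3 / 400)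
          (CollarCore (9 / 2) (-(7175 / 10000)) (1 / 10000) 7 (1 / 20) (1 / 10000)) ∧
        DiluteDefectMotifPricingCapK κT (9 / 5) (133 / 10) (3 / 2) (effPot w₄₅ ω₄ (3 / 400)) (-(7175 / 10000) + 3 / 400)
          (CollarCore (9 / 2) (-(7175 / 10000)) (1 / 10000) 7 (1 / 20) (1 / 10000))) := by
  refine not_collarPiecesK_record_of_not_schurX hκ0 hκ1 ?_
  have h := not_schurTopologicalPricingX_of_checks c cert hG hC hP xc hM hR hκ (CT₄₅ (9 / 5)) (Mball (9 / 2) * CT₄₅ (9 / 5))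
  have e1 : (((-(7175 / 10000) : ℚ)) : ℝ) = -(7175 / 10000) := by norm_num
  have e2 : (((1 / 10000 : ℚ)) : ℝ) = 1 / 10000 := by norm_num
  have e3 : (((7 : ℚ)) : ℝ) = 7 := by norm_num
  have e4 : (((1 / 20 : ℚ)) : ℝ) = 1 / 20 := by norm_num
  simp only [e1, e2, e3, e4] at h
  exact h

end Summit.AtomisticToContinuum.Crystallization.Theorems.FrustratedLawDichotomyCellKitX

end
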